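import Mathlib
import HarnessLib
import Summits.ValiantsHypothesis.ValiantsHypothesis.Theorems.LacunarySymmetroidMatrixDescartesProductPlusOneUnswitchedWindow

/-!
# ValiantsHypothesis / LacunarySymmetroid — crux `MatrixDescartes` (stmt-ValiantsHypothesis-18050, V1),
# LINE (A) «product_plus_one», floor `OneChangeFloorK3`: the BALANCE ZONE — where an incoherent row can break monotonicity (every ratio)

Sequel of ✓ `…ProductPlusOneUnswitchedWindow` (bottom weight `x^{−p}`, `Ψ = Σ_j (p b_j + q c_j x^{q−p})/g_j`, `p = e+1`, `q = e+k+2`).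
The numerator of `Ψ_j′` is `num_j = a c·q(q−p)x^{q−p−1} + x^{p−1}·(q(q−3p)·bc·Z − pq·c²·Z² − p²·b²)`, `Z = x^{q−p}` (✓ `numerator_neg`'s
expansion).  For a no-dip row (`a c < 0`) the first term is negative, and the bracket is `≤ 0` as soon as ONE of the two pure letters dominates
the cross term:

  (top-dominated)     `(q − 3p)·bc ≤ p·c²·Z`        — e.g. `p|c|·x^{q−p} ≥ (q−3p)|b|`,
  (middle-dominated)  `q(q − 3p)·bc·Z ≤ p²·b²`      — e.g. `q(q−3p)|c|·x^{q−p} ≤ p²|b|`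

(`numerator_neg_of_dominated`; both are automatic at ratio `q ≤ 3p`, and for `bc ≤ 0` at ratio `q ≥ 3p`; at ratio `≤ 4` the bracket is
`≤ 0` identically, ✓ `key_identity`).  Hence an INCOHERENT no-dip row (`bc > 0`) at ratio `> 4` can be non-monotone ONLY for
`x^{q−p} ∈ (p²|b|/(q(q−3p)|c|), (q−3p)|b|/(p|c|))` — its BALANCE ZONE, a window of log-width `log(r(r−3)²)/(q−p)` (`r = q/p`) around the
point where its middle and top Euler letters balance — and, by the unswitched-window law, only AFTER its zero.  Consequences
(bottom coupling, `K = 3`, ANY support):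

* `numerator_neg_of_row'`, `hasDerivAt_psi_neg_of_rows'`, `psi_injective_of_rows'` — the pointwise criterion of the unswitched-window law
  extended by the two dominance clauses;
* ★ `euler_window_roots_le_one_of_rows'` — on a zero-free window `[u,v] ⊂ (0,∞)` where every row is, pointwise, opposite its top letter OR a
  no-dip row that is coherent / tame / top-dominated / middle-dominated, `eulerNumerator d a 0` has AT MOST ONE root (line currency, unfolded);
* `topDominated_mono`, ★ `euler_window_roots_le_one_beyond_balance` — top-domination propagates upward, so in a NO-DIP company of ANY ratio
  every zero-free window `[u,v]` lying BEYOND all balance points (`(d₂−d₀−3(d₁−d₀))·a_{j1}a_{j2} ≤ (d₁−d₀)·a_{j2}²·u^{d₂−d₁}` for every row)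
  carries at most ONE critical point — whatever the phases (switched / unswitched) of the rows there;
* `middleDominated_anti`, ★ `euler_window_roots_le_one_before_balance` — the mirror below all balance points.

So at every ratio the floor's excess critical points are confined to the union of the rows' balance zones intersected with their switched
phases; outside it the count is one per zero-free window, as in the tame sector.
HONEST FRAMING: a localisation cell of the research floor; NOT `OneChangeFloorK3` / `stub_eulerBoundK3` / `stub_classRowK3` / `stub_polyLaw` /
`MatrixDescartes`; `VP ≠ VNP` is NOT proved.  No definitions, no named facts; Mathlib + the lane files.
-/

set_option linter.dupNamespace false

namespace Summit.ValiantsHypothesis.ValiantsHypothesis.Theorems.LacunarySymmetroidMatrixDescartes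

namespace ProductPlusOne

open Polynomial Finset
open scoped BigOperators

/-! ### §1 Dominance ⇒ the numerator is negative (no-dip rows, every ratio, every phase) -/

/-- **Dominated no-dip rows are `Ψ`-decreasing** (bottom weight, every ratio, switched or not): `a c < 0`, `x > 0`, and the cross term
dominated by the top letter (`(q−3p)·bc ≤ p·c²·x^{k+1}`) or by the middle letter (`q(q−3p)·bc·x^{k+1} ≤ p²·b²`) ⇒ `num < 0`. [this file's lemma] -/
theorem numerator_neg_of_dominated (a b c : ℝ) (e k : ℕ) (hac : a * c < 0) {x : ℝ} (hx : 0 < x)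
    (hdom : ((e + k + 2 : ℝ) - 3 * (e + 1 : ℝ)) * (b * c) ≤ (e + 1 : ℝ) * c ^ 2 * x ^ (k + 1) ∨
      (e + k + 2 : ℝ) * ((e + k + 2 : ℝ) - 3 * (e + 1 : ℝ)) * (b * c) * x ^ (k + 1) ≤ (e + 1 : ℝ) ^ 2 * b ^ 2) :
    ((e + k + 2 : ℝ) * c * ((k + 1 : ℝ) * x ^ k)) * (a + b * x ^ (e + 1) + c * x ^ (e + k + 2))
        - ((e + 1 : ℝ) * b + (e + k + 2 : ℝ) * c * x ^ (k + 1))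
          * (b * ((e + 1 : ℝ) * x ^ e) + c * ((e + k + 2 : ℝ) * x ^ (e + k + 1))) < 0 := by
  have hid : ((e + k + 2 : ℝ) * c * ((k + 1 : ℝ) * x ^ k)) * (a + b * x ^ (e + 1) + c * x ^ (e + k + 2))
      - ((e + 1 : ℝ) * b + (e + k + 2 : ℝ) * c * x ^ (k + 1))
        * (b * ((e + 1 : ℝ) * x ^ e) + c * ((e + k + 2 : ℝ) * x ^ (e + k + 1)))
      = a * c * ((e + k + 2 : ℝ) * (k + 1 : ℝ)) * x ^ k
        + x ^ e * ((e + k + 2 : ℝ) * ((e + k + 2 : ℝ) - 3 * (e + 1 : ℝ)) * (b * c) * x ^ (k + 1)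
          - (e + 1 : ℝ) * (e + k + 2 : ℝ) * c ^ 2 * (x ^ (k + 1)) ^ 2 - (e + 1 : ℝ) ^ 2 * b ^ 2) := by
    ring
  rw [hid]
  have h1 : a * c * ((e + k + 2 : ℝ) * (k + 1 : ℝ)) * x ^ k < 0 :=
    mul_neg_of_neg_of_pos (mul_neg_of_neg_of_pos hac (by positivity)) (pow_pos hx k)
  have hZ : 0 ≤ x ^ (k + 1) := (pow_pos hx _).le
  have hq : 0 ≤ (e + k + 2 : ℝ) := by positivity
  have hb2 : 0 ≤ (e + 1 : ℝ) ^ 2 * b ^ 2 := by positivity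
  have hc2 : 0 ≤ (e + 1 : ℝ) * (e + k + 2 : ℝ) * c ^ 2 * (x ^ (k + 1)) ^ 2 := by positivity
  have hbr : (e + k + 2 : ℝ) * ((e + k + 2 : ℝ) - 3 * (e + 1 : ℝ)) * (b * c) * x ^ (k + 1)
      - (e + 1 : ℝ) * (e + k + 2 : ℝ) * c ^ 2 * (x ^ (k + 1)) ^ 2 - (e + 1 : ℝ) ^ 2 * b ^ 2 ≤ 0 := by
    rcases hdom with h | h
    · -- top-dominated: `q·Z·((q−3p)bc) ≤ q·Z·(p c² Z)`
      have h' : (e + k + 2 : ℝ) * x ^ (k + 1) * (((e + k + 2 : ℝ) - 3 * (e + 1 : ℝ)) * (b * c))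
          ≤ (e + k + 2 : ℝ) * x ^ (k + 1) * ((e + 1 : ℝ) * c ^ 2 * x ^ (k + 1)) :=
        mul_le_mul_of_nonneg_left h (mul_nonneg hq hZ)
      have e1 : (e + k + 2 : ℝ) * ((e + k + 2 : ℝ) - 3 * (e + 1 : ℝ)) * (b * c) * x ^ (k + 1)
          = (e + k + 2 : ℝ) * x ^ (k + 1) * (((e + k + 2 : ℝ) - 3 * (e + 1 : ℝ)) * (b * c)) := by ring
      have e2 : (e + 1 : ℝ) * (e + k + 2 : ℝ) * c ^ 2 * (x ^ (k + 1)) ^ 2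
          = (e + k + 2 : ℝ) * x ^ (k + 1) * ((e + 1 : ℝ) * c ^ 2 * x ^ (k + 1)) := by ring
      rw [e1, e2]
      linarith
    · linarith
  have h2 : x ^ e * ((e + k + 2 : ℝ) * ((e + k + 2 : ℝ) - 3 * (e + 1 : ℝ)) * (b * c) * x ^ (k + 1)
      - (e + 1 : ℝ) * (e + k + 2 : ℝ) * c ^ 2 * (x ^ (k + 1)) ^ 2 - (e + 1 : ℝ) ^ 2 * b ^ 2) ≤ 0 :=
    mul_nonpos_of_nonneg_of_nonpos (pow_pos hx e).le hbr
  linarith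

/-- **The extended per-row criterion**: at `x > 0` a row is `Ψ`-decreasing if it is opposite its top letter (`c·g(x) < 0`), or a no-dip row
(`a c < 0`) that is coherent (`a b ≥ 0`), tame (`k ≤ 3e+2`), top-dominated or middle-dominated at `x`. [this file's lemma] -/
theorem numerator_neg_of_row' (a b c : ℝ) (e k : ℕ) {x : ℝ} (hx : 0 < x)
    (hrow : c * (a + b * x ^ (e + 1) + c * x ^ (e + k + 2)) < 0 ∨
      (a * c < 0 ∧ (0 ≤ a * b ∨ k ≤ 3 * e + 2 ∨
        ((e + k + 2 : ℝ) - 3 * (e + 1 : ℝ)) * (b * c) ≤ (e + 1 : ℝ) * c ^ 2 * x ^ (k + 1) ∨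
        (e + k + 2 : ℝ) * ((e + k + 2 : ℝ) - 3 * (e + 1 : ℝ)) * (b * c) * x ^ (k + 1) ≤ (e + 1 : ℝ) ^ 2 * b ^ 2))) :
    ((e + k + 2 : ℝ) * c * ((k + 1 : ℝ) * x ^ k)) * (a + b * x ^ (e + 1) + c * x ^ (e + k + 2))
        - ((e + 1 : ℝ) * b + (e + k + 2 : ℝ) * c * x ^ (k + 1))
          * (b * ((e + 1 : ℝ) * x ^ e) + c * ((e + k + 2 : ℝ) * x ^ (e + k + 1))) < 0 := by
  rcases hrow with h | ⟨hac, h | h | h | h⟩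
  · exact numerator_neg_of_unswitched a b c e k hx h
  · exact numerator_neg_of_coherent_any a b c e k hac h hx
  · exact numerator_neg a b c e k h hac hx
  · exact numerator_neg_of_dominated a b c e k hac hx (Or.inl h)
  · exact numerator_neg_of_dominated a b c e k hac hx (Or.inr h)

/-! ### §2 `Ψ′ < 0`, Rolle, and the window law under the extended criterion -/

/-- **`Ψ′ < 0` under the extended criterion** (`m ≥ 1`, `x > 0`, no factor vanishing). [this file's theorem] -/
theorem hasDerivAt_psi_neg_of_rows' {m : ℕ} (hm : 0 < m) (a b c : Fin m → ℝ) (e k : ℕ) {x : ℝ} (hx : 0 < x)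
    (hg : ∀ j, a j + b j * x ^ (e + 1) + c j * x ^ (e + k + 2) ≠ 0)
    (hrow : ∀ j, c j * (a j + b j * x ^ (e + 1) + c j * x ^ (e + k + 2)) < 0 ∨
      (a j * c j < 0 ∧ (0 ≤ a j * b j ∨ k ≤ 3 * e + 2 ∨
        ((e + k + 2 : ℝ) - 3 * (e + 1 : ℝ)) * (b j * c j) ≤ (e + 1 : ℝ) * c j ^ 2 * x ^ (k + 1) ∨
        (e + k + 2 : ℝ) * ((e + k + 2 : ℝ) - 3 * (e + 1 : ℝ)) * (b j * c j) * x ^ (k + 1) ≤ (e + 1 : ℝ) ^ 2 * b j ^ 2))) :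
    ∃ D : ℝ, D < 0 ∧ HasDerivAt (fun y : ℝ => ∑ j, ((e + 1 : ℝ) * b j + (e + k + 2 : ℝ) * c j * y ^ (k + 1))
        / (a j + b j * y ^ (e + 1) + c j * y ^ (e + k + 2))) D x := by
  refine ⟨∑ j, ((((e + k + 2 : ℝ) * c j * ((k + 1 : ℝ) * x ^ k)) * (a j + b j * x ^ (e + 1) + c j * x ^ (e + k + 2))
        - ((e + 1 : ℝ) * b j + (e + k + 2 : ℝ) * c j * x ^ (k + 1))
          * (b j * ((e + 1 : ℝ) * x ^ e) + c j * ((e + k + 2 : ℝ) * x ^ (e + k + 1))))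
        / (a j + b j * x ^ (e + 1) + c j * x ^ (e + k + 2)) ^ 2), ?_, ?_⟩
  · refine Finset.sum_neg (fun j _ => ?_) ⟨⟨0, hm⟩, Finset.mem_univ _⟩
    exact div_neg_of_neg_of_pos (numerator_neg_of_row' (a j) (b j) (c j) e k hx (hrow j)) (by have h0 := hg j; positivity)
  · exact HasDerivAt.fun_sum (u := Finset.univ) (fun j _ => hasDerivAt_term (a j) (b j) (c j) e k (hg j))

/-- **Rolle for `Ψ` under the extended criterion** on a zero-free window `[w₁,w₂] ⊂ (0,∞)`. [this file's lemma] -/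
theorem psi_injective_of_rows' {m : ℕ} (hm : 0 < m) (a b c : Fin m → ℝ) (e k : ℕ) {w₁ w₂ : ℝ} (hw₁ : 0 < w₁) (hw : w₁ < w₂)
    (hfree : ∀ t ∈ Set.Icc w₁ w₂, ∀ j, a j + b j * t ^ (e + 1) + c j * t ^ (e + k + 2) ≠ 0)
    (hrow : ∀ t ∈ Set.Icc w₁ w₂, ∀ j, c j * (a j + b j * t ^ (e + 1) + c j * t ^ (e + k + 2)) < 0 ∨
      (a j * c j < 0 ∧ (0 ≤ a j * b j ∨ k ≤ 3 * e + 2 ∨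
        ((e + k + 2 : ℝ) - 3 * (e + 1 : ℝ)) * (b j * c j) ≤ (e + 1 : ℝ) * c j ^ 2 * t ^ (k + 1) ∨
        (e + k + 2 : ℝ) * ((e + k + 2 : ℝ) - 3 * (e + 1 : ℝ)) * (b j * c j) * t ^ (k + 1) ≤ (e + 1 : ℝ) ^ 2 * b j ^ 2)))
    (heq : (∑ j, ((e + 1 : ℝ) * b j + (e + k + 2 : ℝ) * c j * w₁ ^ (k + 1)) / (a j + b j * w₁ ^ (e + 1) + c j * w₁ ^ (e + k + 2)))
      = ∑ j, ((e + 1 : ℝ) * b j + (e + k + 2 : ℝ) * c j * w₂ ^ (k + 1)) / (a j + b j * w₂ ^ (e + 1) + c j * w₂ ^ (e + k + 2))) :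
    False := by
  have hcont : ContinuousOn (fun y : ℝ => ∑ j, ((e + 1 : ℝ) * b j + (e + k + 2 : ℝ) * c j * y ^ (k + 1))
      / (a j + b j * y ^ (e + 1) + c j * y ^ (e + k + 2))) (Set.Icc w₁ w₂) := by
    intro t ht
    obtain ⟨D, _, hD⟩ := hasDerivAt_psi_neg_of_rows' hm a b c e k (hw₁.trans_le ht.1) (hfree t ht) (hrow t ht)
    exact hD.continuousAt.continuousWithinAt
  obtain ⟨ξ, hξ, hξ'⟩ := exists_deriv_eq_zero hw hcont heq
  obtain ⟨D, hDneg, hD⟩ := hasDerivAt_psi_neg_of_rows' hm a b c e k (hw₁.trans hξ.1)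
    (hfree ξ ⟨hξ.1.le, hξ.2.le⟩) (hrow ξ ⟨hξ.1.le, hξ.2.le⟩)
  rw [hD.deriv] at hξ'
  exact hDneg.ne hξ'

/-- **Window law, normalised chart, extended criterion:** no two zeros of `X·P′` in a window where every factor meets it pointwise
(no factor vanishing). [this file's theorem] -/
theorem X_mul_derivative_no_two_zeros_of_rows' {m : ℕ} (hm : 0 < m) (a b c : Fin m → ℝ) (e k : ℕ) {w₁ w₂ : ℝ}
    (hw₁ : 0 < w₁) (hw : w₁ < w₂)
    (hfree : ∀ t ∈ Set.Icc w₁ w₂, ∀ j, a j + b j * t ^ (e + 1) + c j * t ^ (e + k + 2) ≠ 0)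
    (hrow : ∀ t ∈ Set.Icc w₁ w₂, ∀ j, c j * (a j + b j * t ^ (e + 1) + c j * t ^ (e + k + 2)) < 0 ∨
      (a j * c j < 0 ∧ (0 ≤ a j * b j ∨ k ≤ 3 * e + 2 ∨
        ((e + k + 2 : ℝ) - 3 * (e + 1 : ℝ)) * (b j * c j) ≤ (e + 1 : ℝ) * c j ^ 2 * t ^ (k + 1) ∨
        (e + k + 2 : ℝ) * ((e + k + 2 : ℝ) - 3 * (e + 1 : ℝ)) * (b j * c j) * t ^ (k + 1) ≤ (e + 1 : ℝ) ^ 2 * b j ^ 2)))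
    (h1 : eval w₁ (X * derivative (∏ j, (C (a j) + C (b j) * X ^ (e + 1) + C (c j) * X ^ (e + k + 2)))) = 0)
    (h2 : eval w₂ (X * derivative (∏ j, (C (a j) + C (b j) * X ^ (e + 1) + C (c j) * X ^ (e + k + 2)))) = 0) : False :=
  psi_injective_of_rows' hm a b c e k hw₁ hw hfree hrow
    ((psi_eq_zero_of_eval_X_mul_derivative a b c e k hw₁ (hfree w₁ ⟨le_rfl, hw.le⟩) h1).trans
      (psi_eq_zero_of_eval_X_mul_derivative a b c e k (hw₁.trans hw) (hfree w₂ ⟨hw.le, le_rfl⟩) h2).symm)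

/-- ★ **THE WINDOW LAW WITH BALANCE CLAUSES** (`K = 3`, bottom coupling, ANY support `d 0 < d 1 < d 2`, any `m`).  On a window `[u,v] ⊂ (0,∞)`
free of zeros of the rows, on which at every point `t` every row is opposite its top letter (`a_{j2}·f_j(t) < 0`) OR a no-dip row
(`a_{j0} a_{j2} < 0`) that is coherent (`a_{j0} a_{j1} ≥ 0`), tame (`d 2 − d 0 ≤ 4 (d 1 − d 0)`), TOP-DOMINATED
(`(d₂−d₀−3(d₁−d₀))·a_{j1}a_{j2} ≤ (d₁−d₀)·a_{j2}²·t^{d₂−d₁}`) or MIDDLE-DOMINATED (`(d₂−d₀)(d₂−d₀−3(d₁−d₀))·a_{j1}a_{j2}·t^{d₂−d₁} ≤ (d₁−d₀)²·a_{j1}²`),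
`eulerNumerator d a 0` (unfolded) has AT MOST ONE root. [this file's theorem] -/
theorem euler_window_roots_le_one_of_rows' {m : ℕ} (d : Fin 3 → ℕ) (h01 : d 0 < d 1) (h12 : d 1 < d 2)
    (a : Fin m → Fin 3 → ℝ) {u v : ℝ} (hu : 0 < u)
    (hfree : ∀ t ∈ Set.Icc u v, ∀ j, (∑ l, C (a j l) * X ^ (d l) : ℝ[X]).eval t ≠ 0)
    (hrow : ∀ t ∈ Set.Icc u v, ∀ j,
      a j 2 * (∑ l, C (a j l) * X ^ (d l) : ℝ[X]).eval t < 0 ∨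
      (a j 0 * a j 2 < 0 ∧ (0 ≤ a j 0 * a j 1 ∨ d 2 - d 0 ≤ 4 * (d 1 - d 0) ∨
        (((d 2 : ℝ) - d 0) - 3 * ((d 1 : ℝ) - d 0)) * (a j 1 * a j 2) ≤ ((d 1 : ℝ) - d 0) * a j 2 ^ 2 * t ^ (d 2 - d 1) ∨
        ((d 2 : ℝ) - d 0) * (((d 2 : ℝ) - d 0) - 3 * ((d 1 : ℝ) - d 0)) * (a j 1 * a j 2) * t ^ (d 2 - d 1)
          ≤ ((d 1 : ℝ) - d 0) ^ 2 * a j 1 ^ 2))) :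
    ((∑ j, (∑ l, C (a j l * ((d l : ℝ) - d 0)) * X ^ (d l)) * ∏ i ∈ Finset.univ.erase j, (∑ l, C (a i l) * X ^ (d l))
        : ℝ[X]).roots.toFinset.filter (fun t => u ≤ t ∧ t ≤ v)).card ≤ 1 := by
  classical
  rcases Nat.eq_zero_or_pos m with hm | hm
  · subst hm
    simp only [Finset.univ_eq_empty, Finset.sum_empty, roots_zero, Multiset.toFinset_zero, Finset.filter_empty,
      Finset.card_empty]
    exact Nat.zero_le _
  obtain ⟨e, he⟩ : ∃ e, d 1 = d 0 + e + 1 := ⟨d 1 - d 0 - 1, by omega⟩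
  obtain ⟨k, hk⟩ : ∃ k, d 2 = d 0 + e + k + 2 := ⟨d 2 - d 1 - 1, by omega⟩
  have hk1 : d 2 - d 1 = k + 1 := by omega
  have hp : ((d 1 : ℝ) - d 0) = (e + 1 : ℝ) := by
    rw [he]; push_cast; ring
  have hq : ((d 2 : ℝ) - d 0) = (e + k + 2 : ℝ) := by
    rw [hk]; push_cast; ring
  rw [eulerNumerator_eq d e k he hk a 0, sub_self, mul_zero, map_zero, zero_mul, sub_zero]
  set E : ℝ[X] := X * derivative (∏ j, (C (a j 0) + C (a j 1) * X ^ (e + 1) + C (a j 2) * X ^ (e + k + 2))) with hE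
  by_contra hgt
  push Not at hgt
  obtain ⟨z₁, hz₁, z₂, hz₂, hne⟩ := Finset.one_lt_card.mp hgt
  have hfree' : ∀ w₁ w₂ : ℝ, u ≤ w₁ → w₂ ≤ v → ∀ t ∈ Set.Icc w₁ w₂, ∀ j,
      a j 0 + a j 1 * t ^ (e + 1) + a j 2 * t ^ (e + k + 2) ≠ 0 := by
    intro w₁ w₂ hw₁ hw₂ t ht j
    have h := hfree t ⟨hw₁.trans ht.1, ht.2.trans hw₂⟩ j
    rw [eval_row_eq_pow_mul d e k he hk (a j) t] at h
    exact right_ne_zero_of_mul h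
  have hrow' : ∀ w₁ w₂ : ℝ, u ≤ w₁ → w₂ ≤ v → ∀ t ∈ Set.Icc w₁ w₂, ∀ j,
      a j 2 * (a j 0 + a j 1 * t ^ (e + 1) + a j 2 * t ^ (e + k + 2)) < 0 ∨
      (a j 0 * a j 2 < 0 ∧ (0 ≤ a j 0 * a j 1 ∨ k ≤ 3 * e + 2 ∨
        ((e + k + 2 : ℝ) - 3 * (e + 1 : ℝ)) * (a j 1 * a j 2) ≤ (e + 1 : ℝ) * a j 2 ^ 2 * t ^ (k + 1) ∨
        (e + k + 2 : ℝ) * ((e + k + 2 : ℝ) - 3 * (e + 1 : ℝ)) * (a j 1 * a j 2) * t ^ (k + 1) ≤ (e + 1 : ℝ) ^ 2 * a j 1 ^ 2)) := by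
    intro w₁ w₂ hw₁ hw₂ t ht j
    have htI : t ∈ Set.Icc u v := ⟨hw₁.trans ht.1, ht.2.trans hw₂⟩
    have ht0 : 0 < t := hu.trans_le htI.1
    have htd : 0 < t ^ (d 0) := pow_pos ht0 _
    rcases hrow t htI j with h | ⟨hac, hct⟩
    · left
      rw [eval_row_eq_pow_mul d e k he hk (a j) t, mul_left_comm] at h
      exact neg_of_mul_neg_right h htd.le
    · right
      refine ⟨hac, ?_⟩
      rcases hct with h | h | h | h
      · exact Or.inl h
      · right; left; omega
      · right; right; left
        rw [hp, hq, hk1] at h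
        exact h
      · right; right; right
        rw [hp, hq, hk1] at h
        exact h
  have hmem : ∀ z ∈ (((X : ℝ[X]) ^ (m * d 0) * E).roots.toFinset.filter (fun t => u ≤ t ∧ t ≤ v)),
      u ≤ z ∧ z ≤ v ∧ eval z E = 0 := by
    intro z hz
    rw [mem_filter, Multiset.mem_toFinset] at hz
    by_cases h0 : (X : ℝ[X]) ^ (m * d 0) * E = 0
    · rw [h0, roots_zero] at hz
      exact absurd hz.1 (Multiset.notMem_zero _)
    · have hr := (mem_roots h0).mp hz.1
      rw [IsRoot.def, eval_mul, eval_pow, eval_X] at hr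
      refine ⟨hz.2.1, hz.2.2, ?_⟩
      rcases mul_eq_zero.mp hr with h | h
      · exact absurd h (pow_ne_zero _ (hu.trans_le hz.2.1).ne')
      · exact h
  obtain ⟨hu₁, hv₁, hE₁⟩ := hmem z₁ hz₁
  obtain ⟨hu₂, hv₂, hE₂⟩ := hmem z₂ hz₂
  rcases lt_or_gt_of_ne hne with hlt | hlt
  · exact X_mul_derivative_no_two_zeros_of_rows' hm (fun j => a j 0) (fun j => a j 1) (fun j => a j 2) e k
      (hu.trans_le hu₁) hlt (hfree' z₁ z₂ hu₁ hv₂) (hrow' z₁ z₂ hu₁ hv₂) hE₁ hE₂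
  · exact X_mul_derivative_no_two_zeros_of_rows' hm (fun j => a j 0) (fun j => a j 1) (fun j => a j 2) e k
      (hu.trans_le hu₂) hlt (hfree' z₂ z₁ hu₂ hv₁) (hrow' z₂ z₁ hu₂ hv₁) hE₂ hE₁

/-! ### §3 Beyond / before all balance points: one critical point per zero-free window, whatever the phases -/

/-- **Top-domination propagates upward** (`t ↦ t^n` is monotone on `t ≥ 0` and the right-hand side has the sign of `a₂² ≥ 0`). [folklore] -/
theorem topDominated_mono (κ μ b c : ℝ) (n : ℕ) (hμ : 0 ≤ μ) {u t : ℝ} (hu : 0 ≤ u) (hut : u ≤ t)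
    (h : κ * (b * c) ≤ μ * c ^ 2 * u ^ n) : κ * (b * c) ≤ μ * c ^ 2 * t ^ n :=
  h.trans (mul_le_mul_of_nonneg_left (pow_le_pow_left₀ hu hut n) (mul_nonneg hμ (sq_nonneg c)))

/-- **Middle-domination propagates downward** (`ν ≥ 0`; if `κ·bc ≥ 0` by monotonicity of `t ↦ t^n`, else trivially). [folklore] -/
theorem middleDominated_anti (κ ν b c : ℝ) (n : ℕ) (hν : 0 ≤ ν) {t v : ℝ} (ht : 0 ≤ t) (htv : t ≤ v)
    (h : κ * (b * c) * v ^ n ≤ ν * b ^ 2) : κ * (b * c) * t ^ n ≤ ν * b ^ 2 := by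
  rcases le_or_gt 0 (κ * (b * c)) with hκ | hκ
  · exact (mul_le_mul_of_nonneg_left (pow_le_pow_left₀ ht htv n) hκ).trans h
  · exact (mul_nonpos_of_nonpos_of_nonneg hκ.le (pow_nonneg ht n)).trans (mul_nonneg hν (sq_nonneg b))

/-- ★ **BEYOND ALL BALANCE POINTS** (no-dip company `a_{j0} a_{j2} < 0`, bottom coupling, ANY support `d 0 < d 1 < d 2`): on a zero-free
window `[u,v] ⊂ (0,∞)` at whose LEFT end every row is top-dominated,
`(d₂−d₀−3(d₁−d₀))·a_{j1}a_{j2} ≤ (d₁−d₀)·a_{j2}²·u^{d₂−d₁}` (automatic for coherent rows at ratio `≥ 3` and for every row at ratio `≤ 3`),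
`eulerNumerator d a 0` has at most ONE root — whatever the phases of the rows on the window. [this file's theorem] -/
theorem euler_window_roots_le_one_beyond_balance {m : ℕ} (d : Fin 3 → ℕ) (h01 : d 0 < d 1) (h12 : d 1 < d 2)
    (a : Fin m → Fin 3 → ℝ) (hac : ∀ j, a j 0 * a j 2 < 0) {u v : ℝ} (hu : 0 < u)
    (hfree : ∀ t ∈ Set.Icc u v, ∀ j, (∑ l, C (a j l) * X ^ (d l) : ℝ[X]).eval t ≠ 0)
    (hbal : ∀ j, (((d 2 : ℝ) - d 0) - 3 * ((d 1 : ℝ) - d 0)) * (a j 1 * a j 2) ≤ ((d 1 : ℝ) - d 0) * a j 2 ^ 2 * u ^ (d 2 - d 1)) :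
    ((∑ j, (∑ l, C (a j l * ((d l : ℝ) - d 0)) * X ^ (d l)) * ∏ i ∈ Finset.univ.erase j, (∑ l, C (a i l) * X ^ (d l))
        : ℝ[X]).roots.toFinset.filter (fun t => u ≤ t ∧ t ≤ v)).card ≤ 1 := by
  refine euler_window_roots_le_one_of_rows' d h01 h12 a hu hfree (fun t ht j => Or.inr ⟨hac j, Or.inr (Or.inr (Or.inl ?_))⟩)
  have hμ : 0 ≤ ((d 1 : ℝ) - d 0) := by
    have : (d 0 : ℝ) < d 1 := by exact_mod_cast h01
    linarith
  exact topDominated_mono _ _ (a j 1) (a j 2) (d 2 - d 1) hμ hu.le ht.1 (hbal j)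

/-- ★ **BEFORE ALL BALANCE POINTS** (no-dip company, bottom coupling, ANY support): on a zero-free window `[u,v] ⊂ (0,∞)` at whose RIGHT end
every row is middle-dominated, `(d₂−d₀)(d₂−d₀−3(d₁−d₀))·a_{j1}a_{j2}·v^{d₂−d₁} ≤ (d₁−d₀)²·a_{j1}²`, `eulerNumerator d a 0` has at most ONE root —
whatever the phases of the rows on the window. [this file's theorem] -/
theorem euler_window_roots_le_one_before_balance {m : ℕ} (d : Fin 3 → ℕ) (h01 : d 0 < d 1) (h12 : d 1 < d 2)
    (a : Fin m → Fin 3 → ℝ) (hac : ∀ j, a j 0 * a j 2 < 0) {u v : ℝ} (hu : 0 < u)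
    (hfree : ∀ t ∈ Set.Icc u v, ∀ j, (∑ l, C (a j l) * X ^ (d l) : ℝ[X]).eval t ≠ 0)
    (hbal : ∀ j, ((d 2 : ℝ) - d 0) * (((d 2 : ℝ) - d 0) - 3 * ((d 1 : ℝ) - d 0)) * (a j 1 * a j 2) * v ^ (d 2 - d 1)
      ≤ ((d 1 : ℝ) - d 0) ^ 2 * a j 1 ^ 2) :
    ((∑ j, (∑ l, C (a j l * ((d l : ℝ) - d 0)) * X ^ (d l)) * ∏ i ∈ Finset.univ.erase j, (∑ l, C (a i l) * X ^ (d l))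
        : ℝ[X]).roots.toFinset.filter (fun t => u ≤ t ∧ t ≤ v)).card ≤ 1 := by
  refine euler_window_roots_le_one_of_rows' d h01 h12 a hu hfree (fun t ht j => Or.inr ⟨hac j, Or.inr (Or.inr (Or.inr ?_))⟩)
  exact middleDominated_anti _ _ (a j 1) (a j 2) (d 2 - d 1) (sq_nonneg _) (hu.le.trans ht.1) ht.2 (hbal j)

end ProductPlusOne

end Summit.ValiantsHypothesis.ValiantsHypothesis.Theorems.LacunarySymmetroidMatrixDescartes
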